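import Literature.NumberTheory.Automorphic.CompactGroupOrbitalIntegral
import Literature.NumberTheory.Automorphic.OrbitalMeasureCanonical
import HarnessLib

/-!
# Orbital integrals on a COMPACT group, II: CANONICAL families are plain Haar averages `O_γ(f) = ∫_G f(gγg⁻¹) dν(g)`, and
# `γ ↦ ∫_G f(gγg⁻¹) dν(g)` is LOCALLY CONSTANT on all of `G` for locally constant `f` — through the centre
# (N6nsGerm (S1), brick (C-an): the compact inner form `U(2)_an × L_w¹` at the singular semisimple classes of `U(3)`)

Topic `NumberTheory/Automorphic`; namespace `Literature.NumberTheory.Automorphic`. THEOREMS ONLY (no definition, no instance, no notation, no named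
fact, no `sorry`). Cell `pub/hodgecm-mathlib`, programme P3a, road «N6nsGerm» (LEAD F0P3a-plan (g9) T8-60 (B); A-p16 (g26) menu (m3) = census
`CENSUS-N6nsGerm-S1.A-p16g26.md` §2 (C-an)). Sequel of ★ `CompactGroupOrbitalIntegral` (F0P3a-p08 (g11): `O_γ(f) = t(G_γ)⁻¹ • ∫_G f(gγg⁻¹) dν`,
`continuous_integral_conj`) read against ★ `OrbitalMeasureCanonical` (`OrbitalMeasureFamily.IsCanonical`: the centraliser Haar measure has MASS ONE on
its compact core).

* §1 `OrbitalMeasureFamily.IsCanonical.classOrbitalIntegral_eq_integral_conj_of_compactSpace` — on a compact group the compact core of `G_γ` is all of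
  `G_γ`, so the canonical normalisation is `t(G_γ) = 1` and the factor `t(G_γ)⁻¹` of ★ `orbitalIntegral_quotientMeasure_eq_inv_smul` DISAPPEARS:
  `classOrbitalIntegral m f c = ∫_G f(g γ_c g⁻¹) dν(g)` at every pinned class; `…_of_mk_eq` — the same with ANY representative `γ ∈ c`.
* §2 `eventually_forall_conj_eq_of_isLocallyConstant`, **`isLocallyConstant_integral_conj`** — `G` compact, `f` locally constant, ANY measure `μ`:
  `γ ↦ ∫_G f(gγg⁻¹) dμ(g)` is LOCALLY CONSTANT on all of `G` (the locally-constant companion of ★ `continuous_integral_conj`; compactness makes the local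
  constancy of `(γ, g) ↦ f(gγg⁻¹)` uniform in `g`); **`OrbitalMeasureFamily.IsCanonical.exists_isLocallyConstant_classOrbitalIntegral_eq`** — the
  assembled (C-an) head: ONE locally constant `Ψ : G → E`, `Ψ γ = ∫_G f(gγg⁻¹) dν(g)`, with `classOrbitalIntegral m f ⟦γ⟧ = Ψ γ` at every `γ` whose class
  is pinned; `Ψ` is defined and locally constant at the central `γ` as well («orbital integrals of the compact inner form are of constant type through
  the centre», the input of the rank-one inner transfer in Rogawski's Prop. 8.2.1 (a)(d)).

HONEST SCOPE. Abstract harmonic analysis on compact groups only; nothing here identifies `U(2)_an × L_w¹` or proves its compactness (★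
`isCompact_unitaryGroupOfForm_of_anisotropic`). HC_CM is proved only modulo the printed citations until rung 0 closes; this file discharges no printed
statement.

## References
* [Rogawski1990] J. D. Rogawski, *Automorphic Representations of Unitary Groups in Three Variables*, Ann. of Math. Stud. 123 (1990), §4.3 (4.3.1) p. 43,
  §4.9 p. 54, §8.2 Prop. 8.2.1 pp. 118–122, §14.5 Lemma 14.5.2 (b) proof p. 238.
* [Folland1995] G. B. Folland, *A Course in Abstract Harmonic Analysis* (1995), §2.6 Thm. 2.49, (2.52).
* [DeitmarEchterhoff2014] A. Deitmar, S. Echterhoff, *Principles of Harmonic Analysis*, 2nd ed. (2014), Thm. 1.5.3, Cor. 1.5.4.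
-/

set_option autoImplicit false

noncomputable section

open _root_.MeasureTheory _root_.MeasureTheory.Measure _root_.Topology Set Filter Function
open scoped ENNReal NNReal
open Literature.MeasureTheory.Group

namespace Literature.NumberTheory.Automorphic

/-! ## §1 Canonical families on a compact group: the centraliser mass is one -/

section Canonical

variable {G : Type*} [Group G] [TopologicalSpace G] [IsTopologicalGroup G] [CompactSpace G] [LocallyCompactSpace G]
  [SecondCountableTopology G] [T2Space G] [MeasurableSpace G] [BorelSpace G]
  [∀ γ : G, MeasurableSpace (G ⧸ Subgroup.centralizer ({γ} : Set G))]
  [∀ γ : G, BorelSpace (G ⧸ Subgroup.centralizer ({γ} : Set G))]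
  (ν : Measure G) [IsHaarMeasure ν] [ν.IsMulRightInvariant]
  {E : Type*} [NormedAddCommGroup E] [NormedSpace ℝ E]

omit [LocallyCompactSpace G] [SecondCountableTopology G] [MeasurableSpace G] [BorelSpace G]
  [∀ γ : G, MeasurableSpace (G ⧸ Subgroup.centralizer ({γ} : Set G))] [∀ γ : G, BorelSpace (G ⧸ Subgroup.centralizer ({γ} : Set G))] in
/-- On a compact group the compact core (★ `compactCore`) of every centraliser is the whole centraliser. [cite: Rogawski1990, §4.3 p. 43] -/
theorem compactCore_centralizer_eq_univ_of_compactSpace (γ : G) :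
    compactCore ↥(Subgroup.centralizer ({γ} : Set G)) = Set.univ := by
  haveI : CompactSpace ↥(Subgroup.centralizer ({γ} : Set G)) :=
    isCompact_iff_compactSpace.1 (isClosed_coe_centralizer_singleton γ).isCompact
  exact compactCore_eq_univ _

/-- **CANONICAL ORBITAL INTEGRALS ON A COMPACT GROUP ARE PLAIN HAAR AVERAGES**: for `m` canonical for `(P, ν)` (★ `OrbitalMeasureFamily.IsCanonical`)
on a compact group and a class `c` with `P(γ_c)`, `γ_c = out c`: `classOrbitalIntegral m f c = ∫_G f(g γ_c g⁻¹) dν(g)` for continuous `f` — the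
centraliser mass of ★ `orbitalIntegral_quotientMeasure_eq_inv_smul` is `t(G_{γ_c}) = t(compactCore G_{γ_c}) = 1`.
[cite: Rogawski1990, §4.3 (4.3.1) p. 43; §14.5 p. 239] [cite: Folland1995, §2.6 (2.52)] -/
theorem OrbitalMeasureFamily.IsCanonical.classOrbitalIntegral_eq_integral_conj_of_compactSpace {P : G → Prop} {m : OrbitalMeasureFamily G}
    (h : m.IsCanonical P ν) {c : ConjClasses G} (hc : P (Quotient.out c)) (f : G → E) (hf : Continuous f) :
    classOrbitalIntegral m f c = ∫ g, f (g * Quotient.out c * g⁻¹) ∂ν := by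
  obtain ⟨t, ht, hti, htc, hm⟩ := h c hc
  rw [compactCore_centralizer_eq_univ_of_compactSpace] at htc
  have h1 : t.real Set.univ = 1 := by rw [measureReal_def, htc, ENNReal.toReal_one]
  rw [classOrbitalIntegral_eq, hm, orbitalIntegral_quotientMeasure_eq_inv_smul ν _ t f hf, h1, inv_one, one_smul]

/-- The same with ANY representative: `⟦γ⟧ = c` ⇒ `classOrbitalIntegral m f c = ∫_G f(g γ g⁻¹) dν(g)` (`ν` right invariant: `g ↦ g x` preserves `ν`).
[cite: Rogawski1990, §4.9 p. 54] [cite: Folland1995, §2.6 (2.52)] -/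
theorem OrbitalMeasureFamily.IsCanonical.classOrbitalIntegral_eq_integral_conj_of_mk_eq {P : G → Prop} {m : OrbitalMeasureFamily G}
    (h : m.IsCanonical P ν) {c : ConjClasses G} (hc : P (Quotient.out c)) (f : G → E) (hf : Continuous f)
    (γ : G) (hγ : ConjClasses.mk γ = c) :
    classOrbitalIntegral m f c = ∫ g, f (g * γ * g⁻¹) ∂ν := by
  rw [h.classOrbitalIntegral_eq_integral_conj_of_compactSpace ν hc f hf]
  -- `out c = x γ x⁻¹`
  have hmk : ConjClasses.mk (Quotient.out c) = c := Quotient.out_eq c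
  obtain ⟨x, hx⟩ := ConjClasses.mk_eq_mk_iff_isConj.1 (hγ.trans hmk.symm)
  have hout : Quotient.out c = (x : G) * γ * (x : G)⁻¹ := by
    rw [hx.eq, mul_inv_cancel_right]
  simp_rw [hout]
  have h3 : ∀ g : G, g * ((x : G) * γ * (x : G)⁻¹) * g⁻¹ = (g * x) * γ * (g * x)⁻¹ := fun g => by group
  simp_rw [h3]
  exact integral_mul_right_eq_self (fun y => f (y * γ * y⁻¹)) (x : G)

end Canonical

/-! ## §2 `γ ↦ ∫_G f(gγg⁻¹) dμ(g)` is locally constant on all of a compact group -/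

section LocallyConstant

variable {G : Type*} [Group G] [TopologicalSpace G] [IsTopologicalGroup G] [CompactSpace G]

/-- **Uniform local constancy of the conjugated integrand on a compact group**: if `f` is locally constant then, for `γ′` near `γ`,
`f(g γ′ g⁻¹) = f(g γ g⁻¹)` for ALL `g ∈ G` simultaneously (`(γ′, g) ↦ f(gγ′g⁻¹)` is locally constant on `G × G`; compactness in `g`).
[cite: Folland1995, §2.6] [cite: Rogawski1990, §14.5 Lemma 14.5.2 (b) proof p. 238] -/
theorem eventually_forall_conj_eq_of_isLocallyConstant {α : Type*} {f : G → α} (hf : IsLocallyConstant f) (γ : G) :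
    ∀ᶠ γ' in 𝓝 γ, ∀ g : G, f (g * γ' * g⁻¹) = f (g * γ * g⁻¹) := by
  have h := (isCompact_univ (X := G)).eventually_forall_of_forall_eventually (x₀ := γ)
    (P := fun γ' g => f (g * γ' * g⁻¹) = f (g * γ * g⁻¹)) ?_
  · exact h.mono fun γ' hγ' g => hγ' g (mem_univ g)
  · intro g _
    have hc1 : Continuous fun q : G × G => q.2 * q.1 * q.2⁻¹ := by fun_prop
    have hc2 : Continuous fun q : G × G => q.2 * γ * q.2⁻¹ := by fun_prop
    filter_upwards [(hf.comp_continuous hc1).eventually_eq (x := (γ, g)), (hf.comp_continuous hc2).eventually_eq (x := (γ, g))] with q hq1 hq2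
    simp only [Function.comp_apply] at hq1 hq2
    rw [hq1, ← hq2]

variable [MeasurableSpace G] {E : Type*} [NormedAddCommGroup E] [NormedSpace ℝ E]

/-- **(C-an) `γ ↦ ∫_G f(gγg⁻¹) dμ(g)` IS LOCALLY CONSTANT ON ALL OF A COMPACT GROUP** for `f` locally constant and ANY measure `μ` — in particular at
central `γ`, with no normalising factor (the locally-constant companion of ★ `continuous_integral_conj`).
[cite: Rogawski1990, §8.2 Prop. 8.2.1 pp. 118–122; §14.5 Lemma 14.5.2 (b) proof p. 238] [cite: Folland1995, §2.6] -/
theorem isLocallyConstant_integral_conj (μ : Measure G) {f : G → E} (hf : IsLocallyConstant f) :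
    IsLocallyConstant fun γ : G => ∫ g, f (g * γ * g⁻¹) ∂μ := by
  refine (IsLocallyConstant.iff_eventually_eq _).2 fun γ => ?_
  filter_upwards [eventually_forall_conj_eq_of_isLocallyConstant hf γ] with γ' hγ'
  simp_rw [hγ']

variable [LocallyCompactSpace G] [SecondCountableTopology G] [T2Space G] [BorelSpace G]
  [∀ γ : G, MeasurableSpace (G ⧸ Subgroup.centralizer ({γ} : Set G))]
  [∀ γ : G, BorelSpace (G ⧸ Subgroup.centralizer ({γ} : Set G))]

/-- **(C-an) ASSEMBLED: canonical orbital integrals on a compact group extend to ONE locally constant function through the centre.** `G` compact, `ν` a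
Haar measure (also right invariant), `m` canonical for `(P, ν)`, `f` locally constant: there is a locally constant `Ψ : G → E` — namely
`Ψ γ = ∫_G f(g γ g⁻¹) dν(g)` — with `classOrbitalIntegral m f ⟦γ⟧ = Ψ γ` at EVERY `γ` whose class is pinned (`P (out ⟦γ⟧)`); `Ψ` is defined and locally
constant at the central `γ` too, pinned or not. [cite: Rogawski1990, §8.2 Prop. 8.2.1 pp. 118–122; §4.3 p. 43] [cite: DeitmarEchterhoff2014, Cor. 1.5.4] -/
theorem OrbitalMeasureFamily.IsCanonical.exists_isLocallyConstant_classOrbitalIntegral_eq (ν : Measure G) [IsHaarMeasure ν]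
    [ν.IsMulRightInvariant] {P : G → Prop} {m : OrbitalMeasureFamily G} (h : m.IsCanonical P ν) {f : G → E} (hf : IsLocallyConstant f) :
    ∃ Ψ : G → E, IsLocallyConstant Ψ ∧ (∀ γ, Ψ γ = ∫ g, f (g * γ * g⁻¹) ∂ν) ∧
      ∀ γ : G, P (Quotient.out (ConjClasses.mk γ)) → classOrbitalIntegral m f (ConjClasses.mk γ) = Ψ γ :=
  ⟨fun γ => ∫ g, f (g * γ * g⁻¹) ∂ν, isLocallyConstant_integral_conj ν hf, fun _ => rfl,
    fun γ hγ => h.classOrbitalIntegral_eq_integral_conj_of_mk_eq ν hγ f hf.continuous γ rfl⟩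

end LocallyConstant

end Literature.NumberTheory.Automorphic
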